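import Literature.Analysis.FluidPDE.CompressibleEulerImplosionConeIdentification
import Literature.Analysis.FluidPDE.CompressibleEulerProfileFieldAsymptotics
import Literature.Analysis.FluidPDE.CompressibleEulerExactSolutionDerivativeBounds
import Literature.Analysis.FluidPDE.CompressibleEulerProfileFarFieldLowerBound
import HarnessLib

/-!
# Bounds for the exact self-similar implosion that are UNIFORM in the blow-up time
# (theorems only)

Topic `Literature/Analysis/FluidPDE`; namespace `Literature.Analysis.FluidPDE.CaolaboraEtAl2025`.
Sequel of `CompressibleEulerExactSelfSimilarImplosion.lean`, `CompressibleEulerImplosionConeIdentification.lean`,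
`CompressibleEulerProfileFieldAsymptotics.lean` and `CompressibleEulerProfileFarFieldLowerBound.lean`.
THEOREMS ONLY, no new facts (D-0026).

The exact self-similar solution of the isentropic Euler equations of the monatomic gas generated by
a profile `(Ū, S̄)` as in `BuckmasterCaolaboraGomezserrano2025_thm11_monatomic`,
`u_T(t,x) = r⁻¹(T−t)^{1/r−1}Ū(x(T−t)^{−1/r})`, `σ_T(t,x) = r⁻¹(T−t)^{1/r−1}S̄(x(T−t)^{−1/r})`,
`ρ_T = (σ_T/3)³`, depends on the blow-up time `T` only through `T − t`. The companion files state
its acoustic bound, its domain-of-dependence property and its far-field regularity with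
constants introduced AFTER the blow-up time; the deduction of the periodic implosion from the
Euclidean one "via finite speed of propagation" (Cao-Labora–Gómez-Serrano–Shi–Staffilani, Rem. 1.5
p. 7 of the held text `paper-arxiv-2310.05325`) chooses the blow-up time SMALL in terms of these
very constants, so it needs them in the `T`-uniform order of quantifiers `∃ C, ∀ T`. This file
re-derives them in that form (same proofs):

* `speed_bound_uniform`: `‖u_T‖ + |σ_T/3| ≤ M r⁻¹(T−t)^{1/r−1}` with ONE `M` for all `T`;
* `eqOn_cone_uniform`, `lift_eq_exact_on_cone_uniform`: the domain of dependence at the core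
  (Dafermos 2005, Thm 5.2.1, through `IsentropicEuler.eqOn_cone_of_eqOn_ball_var`) with one
  acoustic constant `M` for all `T`;
* `farField_iteratedFDeriv_uniform`: eq. (1.6) transported to the exact solution,
  `‖∇ⁿu_T(t,·)(x)‖, ‖∇ⁿσ_T(t,·)(x)‖ ≤ C|x|^{1−r−n}` for `|x| ≥ R(T−t)^{1/r}`, with `R, C` independent
  of `t` AND `T`;
* `farField_soundSpeed_lower_uniform`: `σ_T(t,x) ≥ c|x|^{1−r}` for `|x| ≥ R(T−t)^{1/r}`, `c, R`
  independent of `t`, `T` (from `S̄(ζ) ≥ cζ^{1−r}`, `profile_soundSpeed_lower`).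

[cite: CaolaboraEtAl2025, §1.3 p. 5, eq. (1.6) p. 6, Rem 1.5 p. 7] [cite: Dafermos2005, §5.2, Thm 5.2.1]
-/

noncomputable section

open Set Filter MeasureTheory
open scoped Topology ContDiff

namespace Literature.Analysis.FluidPDE

open Literature.MathematicalPhysics.KineticTheory (T3 V3)
open Literature.Analysis.FunctionSpaces

namespace CaolaboraEtAl2025

variable {r : ℝ} {U S : ℝ → ℝ} {Ub : V3 → V3} {Sb : V3 → ℝ}

/-! ### The acoustic bound -/

section Speed

/-- **`T`-uniform integrable speed bound.** With `M` a bound for the profile fields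
(`exists_bound_profile`), for EVERY blow-up time `T`, all `t < T` and all `x`:
`‖u_T(t,x)‖ + |σ_T(t,x)/3| ≤ (4M/3) r⁻¹ (T−t)^{1/r−1}`.
[cite: CaolaboraEtAl2025, §1.3 p. 5 (self-similar ansatz), Rem. 1.5 p. 7] -/
theorem speed_bound_uniform (hr : 1 < r)
    (hU : ContDiff ℝ ∞ fun y : V3 => (U ‖y‖ / ‖y‖) • y) (hS : ContDiff ℝ ∞ fun y : V3 => S ‖y‖)
    (hode : ∀ ζ : ℝ, 0 < ζ →
      (r - 1) * U ζ + (ζ + U ζ) * deriv U ζ + 1 / 3 * S ζ * deriv S ζ = 0 ∧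
      (r - 1) * S ζ + (ζ + U ζ) * deriv S ζ + 1 / 3 * S ζ * (deriv U ζ + 2 * U ζ / ζ) = 0)
    (hlimU : Tendsto (fun ζ => U ζ / ζ) atTop (𝓝 0))
    (hlimS : Tendsto (fun ζ => S ζ / ζ) atTop (𝓝 0))
    (hUb : Ub = fun y : V3 => (U ‖y‖ / ‖y‖) • y) (hSb : Sb = fun y : V3 => S ‖y‖) :
    ∃ M : ℝ, 0 ≤ M ∧ ∀ (T : ℝ) (u : ℝ → V3 → V3) (σ : ℝ → V3 → ℝ),
      (∀ t x, u t x = (r⁻¹ * (T - t) ^ (1 / r - 1)) • Ub ((T - t) ^ (-1 / r) • x)) →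
      (∀ t x, σ t x = (r⁻¹ * (T - t) ^ (1 / r - 1)) * Sb ((T - t) ^ (-1 / r) • x)) →
      ∀ t < T, ∀ x, ‖u t x‖ + |1 / 3 * σ t x| ≤ M * (r⁻¹ * (T - t) ^ (1 / r - 1)) := by
  obtain ⟨M, hM0, hM⟩ := exists_bound_profile hr hU hS hode hlimU hlimS
  have hr0 : 0 < r := by linarith
  refine ⟨M + M / 3, by positivity, fun T u σ hu hσ t ht x => ?_⟩
  have hl0 : 0 < T - t := sub_pos.mpr ht
  have ha : 0 < r⁻¹ * (T - t) ^ (1 / r - 1) := mul_pos (inv_pos.2 hr0) (Real.rpow_pos_of_pos hl0 _)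
  set y : V3 := (T - t) ^ (-1 / r) • x with hy
  have h1 : ‖Ub y‖ ≤ M := by rw [hUb]; exact (hM y).1
  have h2 : |Sb y| ≤ M := by rw [hSb]; exact (hM y).2
  have hnu : ‖u t x‖ = (r⁻¹ * (T - t) ^ (1 / r - 1)) * ‖Ub y‖ := by
    rw [hu, norm_smul, Real.norm_eq_abs, abs_of_pos ha]
  have hnσ : |1 / 3 * σ t x| = (r⁻¹ * (T - t) ^ (1 / r - 1)) * (|Sb y| / 3) := by
    rw [hσ, ← hy, abs_mul, abs_mul, abs_of_pos ha, abs_of_pos (by norm_num : (0 : ℝ) < 1 / 3)]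
    ring
  rw [hnu, hnσ]
  have h1' := mul_le_mul_of_nonneg_left h1 ha.le
  have h2' := mul_le_mul_of_nonneg_left h2 ha.le
  nlinarith [h1', h2']

end Speed

/-! ### The domain of dependence at the core, uniformly in the blow-up time -/

section Cone

/-- **Domain of dependence at the implosion core, `(u, σ)` form, `T`-uniform acoustic constant.**
There is `M ≥ 0` (depending only on the profile and `r`) such that for EVERY blow-up time `T`:
every `C¹` solution `(u₂, σ₂)` of the `(u, σ)`-system (`α = 1/3`) on a slab `[0, t₁) × ℝ³`,
`t₁ < T`, whose data agree with the exact self-similar data on the ball `‖x − x₀‖ < R` coincides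
with the exact solution on the cone `‖x − x₀‖ + M (T^{1/r} − (T−t)^{1/r}) < R`, `0 ≤ t < t₁`.
(Same proof as `eqOn_cone_of_profile`, with the speed bound of `speed_bound_uniform`.)
[cite: Dafermos2005, §5.2, Thm 5.2.1] [cite: CaolaboraEtAl2025, Rem 1.5 p. 7; §1.3 p. 5] -/
theorem eqOn_cone_uniform (hr : 1 < r)
    (hU : ContDiff ℝ ∞ fun y : V3 => (U ‖y‖ / ‖y‖) • y) (hS : ContDiff ℝ ∞ fun y : V3 => S ‖y‖)
    (hode : ∀ ζ : ℝ, 0 < ζ →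
      (r - 1) * U ζ + (ζ + U ζ) * deriv U ζ + 1 / 3 * S ζ * deriv S ζ = 0 ∧
      (r - 1) * S ζ + (ζ + U ζ) * deriv S ζ + 1 / 3 * S ζ * (deriv U ζ + 2 * U ζ / ζ) = 0)
    (hlimU : Tendsto (fun ζ => U ζ / ζ) atTop (𝓝 0))
    (hlimS : Tendsto (fun ζ => S ζ / ζ) atTop (𝓝 0))
    (hUb : Ub = fun y : V3 => (U ‖y‖ / ‖y‖) • y) (hSb : Sb = fun y : V3 => S ‖y‖) :
    ∃ M : ℝ, 0 ≤ M ∧ ∀ (T : ℝ) (u : ℝ → V3 → V3) (σ : ℝ → V3 → ℝ),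
      (∀ t x, u t x = (r⁻¹ * (T - t) ^ (1 / r - 1)) • Ub ((T - t) ^ (-1 / r) • x)) →
      (∀ t x, σ t x = (r⁻¹ * (T - t) ^ (1 / r - 1)) * Sb ((T - t) ^ (-1 / r) • x)) →
      ∀ ⦃t₁ : ℝ⦄, t₁ < T →
      ∀ ⦃u₂ : ℝ → V3 → V3⦄ ⦃σ₂ : ℝ → V3 → ℝ⦄ ⦃x₀ : V3⦄ ⦃R : ℝ⦄,
        ContDiffOn ℝ 1 (fun p : ℝ × V3 => u₂ p.1 p.2) (Ico 0 t₁ ×ˢ univ) →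
        ContDiffOn ℝ 1 (fun p : ℝ × V3 => σ₂ p.1 p.2) (Ico 0 t₁ ×ˢ univ) →
        (∀ t ∈ Ioo 0 t₁, ∀ x, ‖x - x₀‖ + M * (T ^ (1 / r) - (T - t) ^ (1 / r)) < R →
          deriv (fun s => σ₂ s x) t + fderiv ℝ (σ₂ t) x (u₂ t x) +
              1 / 3 * σ₂ t x * ∑ i, fderiv ℝ (u₂ t) x (EuclideanSpace.single i 1) i = 0 ∧
            deriv (fun s => u₂ s x) t + fderiv ℝ (u₂ t) x (u₂ t x) +
              (1 / 3 * σ₂ t x) • gradient (σ₂ t) x = 0) →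
        (∀ x, ‖x - x₀‖ < R → u 0 x = u₂ 0 x ∧ σ 0 x = σ₂ 0 x) →
        ∀ ⦃t : ℝ⦄, t ∈ Ico 0 t₁ → ∀ ⦃x : V3⦄,
          ‖x - x₀‖ + M * (T ^ (1 / r) - (T - t) ^ (1 / r)) < R →
          u t x = u₂ t x ∧ σ t x = σ₂ t x := by
  obtain ⟨M, hM0, hM⟩ := speed_bound_uniform hr hU hS hode hlimU hlimS hUb hSb
  refine ⟨M, hM0, ?_⟩
  intro T u σ hu hσ t₁ ht₁ u₂ σ₂ x₀ R hu₂ hσ₂ hE₂ h0 t ht x hx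
  have hMT := hM T u σ hu hσ
  have hr0 : 0 < r := one_pos.trans hr
  have hUb1 : ContDiff ℝ 1 Ub := hUb ▸ hU.of_le (by norm_cast)
  have hSb1 : ContDiff ℝ 1 Sb := hSb ▸ hS.of_le (by norm_cast)
  have hP1 : ∀ y, (r - 1) • Ub y + fderiv ℝ Ub y (y + Ub y) +
      (1 / 3 * Sb y) • gradient Sb y = 0 := by
    subst hUb hSb; exact profileEq_velocity hU hS hode
  have hP2 : ∀ y, (r - 1) * Sb y + fderiv ℝ Sb y (y + Ub y) +
      1 / 3 * Sb y * ∑ i, (fderiv ℝ Ub y (EuclideanSpace.single i 1)) i = 0 := by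
    subst hUb hSb; exact profileEq_soundSpeed hU hS hode
  -- joint regularity of the exact solution on the slab (indeed on `{t < T}`)
  have hsm : ContDiffOn ℝ 1 (fun p : ℝ × V3 => u p.1 p.2) (Ico 0 t₁ ×ˢ univ) ∧
      ContDiffOn ℝ 1 (fun p : ℝ × V3 => σ p.1 p.2) (Ico 0 t₁ ×ˢ univ) := by
    have hsub : Ico 0 t₁ ×ˢ (univ : Set V3) ⊆ {p : ℝ × V3 | p.1 < T} :=
      fun p hp => hp.1.2.trans ht₁
    have hl : ContDiffOn ℝ 1 (fun p : ℝ × V3 => T - p.1) {p | p.1 < T} :=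
      (contDiff_const.sub contDiff_fst).contDiffOn
    have hl0 : ∀ p ∈ {p : ℝ × V3 | p.1 < T}, T - p.1 ≠ 0 := fun p hp => (sub_pos.mpr hp).ne'
    have hamp : ContDiffOn ℝ 1 (fun p : ℝ × V3 => r⁻¹ * (T - p.1) ^ (1 / r - 1)) {p | p.1 < T} :=
      contDiffOn_const.mul (hl.rpow_const_of_ne hl0)
    have hy : ContDiffOn ℝ 1 (fun p : ℝ × V3 => (T - p.1) ^ (-1 / r) • p.2) {p | p.1 < T} :=
      (hl.rpow_const_of_ne hl0).smul contDiff_snd.contDiffOn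
    have hU' : ContDiffOn ℝ 1 (fun p : ℝ × V3 => Ub ((T - p.1) ^ (-1 / r) • p.2))
        {p | p.1 < T} := hUb1.comp_contDiffOn hy
    have hS' : ContDiffOn ℝ 1 (fun p : ℝ × V3 => Sb ((T - p.1) ^ (-1 / r) • p.2))
        {p | p.1 < T} := hSb1.comp_contDiffOn hy
    exact ⟨((hamp.smul hU').congr fun p _ => hu p.1 p.2).mono hsub,
      ((hamp.mul hS').congr fun p _ => hσ p.1 p.2).mono hsub⟩
  -- the speed bound frozen after `t₁`, and the acoustic radius it sweeps out
  have hmin : ∀ s : ℝ, min s t₁ < T := fun s => (min_le_right s t₁).trans_lt ht₁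
  set c : ℝ → ℝ := fun s => M * (r⁻¹ * (T - min s t₁) ^ (1 / r - 1)) with hc
  have hcc : Continuous c := by
    refine continuous_const.mul (continuous_const.mul ?_)
    exact (continuous_const.sub (continuous_id.min continuous_const)).rpow_const
      fun s => Or.inl (sub_pos.2 (hmin s)).ne'
  have hc0 : ∀ s, 0 ≤ c s := fun s =>
    mul_nonneg hM0 (mul_nonneg (inv_nonneg.2 hr0.le) (Real.rpow_nonneg (sub_pos.2 (hmin s)).le _))
  set Γ : ℝ → ℝ := fun s => ∫ τ in (0 : ℝ)..s, c τ with hΓ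
  have hΓd : ∀ s, HasDerivAt Γ (c s) s := fun s =>
    (hcc.integral_hasStrictDerivAt 0 s).hasDerivAt
  have hΓ0 : Γ 0 = 0 := by simp [hΓ]
  have hΓG : ∀ s ∈ Icc 0 t₁, Γ s = M * (T ^ (1 / r) - (T - s) ^ (1 / r)) := by
    intro s hs
    have h1 : (∫ τ in (0 : ℝ)..s, c τ) =
        ∫ τ in (0 : ℝ)..s, M * (r⁻¹ * (T - τ) ^ (1 / r - 1)) := by
      refine intervalIntegral.integral_congr fun τ hτ => ?_
      rw [uIcc_of_le hs.1] at hτ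
      simp only [hc, min_eq_left (hτ.2.trans hs.2)]
    simp only [hΓ]
    rw [h1, coneRadius_eq_integral hs.1 (hs.2.trans_lt ht₁)]
  -- apply the domain-of-dependence theorem with the variable speed bound
  have hT : ∀ s ∈ Ioo 0 t₁, s < T := fun s hs => hs.2.trans ht₁
  refine IsentropicEuler.eqOn_cone_of_eqOn_ball_var (α := 1 / 3) (c := c) (Γ := Γ) (R := R)
    (x₀ := x₀) hsm.1 hu₂ hsm.2 hσ₂ (fun s hs y _ => ?_) (fun s hs y hy => ?_)
    (fun s hs y _ => ?_) hcc hc0 hΓd hΓ0 h0 ht ?_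
  · -- the exact solution solves the `(u, σ)`-system
    obtain ⟨-, -, -, -, hMom, hZ⟩ :=
      uσ_system_of_ansatz hr0.ne' hUb1 hSb1 hP1 hP2 hu hσ (hT s hs) y
    exact ⟨hZ, hMom⟩
  · -- the second solution, on the cone written with `Γ`
    refine hE₂ s hs y ?_
    rwa [hΓG s ⟨hs.1.le, hs.2.le⟩] at hy
  · -- the speed bound
    have h := hMT s (hT s hs) y
    simp only [hc, min_eq_left hs.2.le]
    exact h
  · rwa [hΓG t ⟨ht.1, ht.2.le⟩]

/-- **Domain of dependence at the implosion core, periodic classical solutions, `T`-uniform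
acoustic constant.** There is `M ≥ 0` such that for EVERY blow-up time `T`: every classical
solution `(ρ₂, u₂)` on `[0, T₂) × 𝕋³` (`IsIsentropicEulerSolution (5/3) T₂ ρ₂ u₂`) whose lifted data
agree with the exact `(ρ_T, u_T)(0, ·)` on the ball `‖y − x₀‖ < R` of `ℝ³` has its lift EQUAL to
`(ρ_T, u_T)` on the curved cone `‖y − x₀‖ + M (T^{1/r} − (T−t)^{1/r}) < R` for `0 ≤ t < T₂`,
`t < T` (same proof as `lift_eq_exact_on_cone`). [cite: CaolaboraEtAl2025, Rem 1.5 p. 7]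
[cite: Dafermos2005, §5.2, Thm 5.2.1] -/
theorem lift_eq_exact_on_cone_uniform (hr : 1 < r)
    (hU : ContDiff ℝ ∞ fun y : V3 => (U ‖y‖ / ‖y‖) • y) (hS : ContDiff ℝ ∞ fun y : V3 => S ‖y‖)
    (hode : ∀ ζ : ℝ, 0 < ζ →
      (r - 1) * U ζ + (ζ + U ζ) * deriv U ζ + 1 / 3 * S ζ * deriv S ζ = 0 ∧
      (r - 1) * S ζ + (ζ + U ζ) * deriv S ζ + 1 / 3 * S ζ * (deriv U ζ + 2 * U ζ / ζ) = 0)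
    (hSpos : ∀ ζ : ℝ, 0 ≤ ζ → 0 < S ζ)
    (hlimU : Tendsto (fun ζ => U ζ / ζ) atTop (𝓝 0))
    (hlimS : Tendsto (fun ζ => S ζ / ζ) atTop (𝓝 0))
    (hUb : Ub = fun y : V3 => (U ‖y‖ / ‖y‖) • y) (hSb : Sb = fun y : V3 => S ‖y‖) :
    ∃ M : ℝ, 0 ≤ M ∧ ∀ (T : ℝ) (u : ℝ → V3 → V3) (σ ρ : ℝ → V3 → ℝ),
      (∀ t x, u t x = (r⁻¹ * (T - t) ^ (1 / r - 1)) • Ub ((T - t) ^ (-1 / r) • x)) →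
      (∀ t x, σ t x = (r⁻¹ * (T - t) ^ (1 / r - 1)) * Sb ((T - t) ^ (-1 / r) • x)) →
      (∀ t x, ρ t x = (σ t x / 3) ^ 3) →
      ∀ ⦃T₂ : ℝ⦄ ⦃ρ₂ : ℝ → T3 → ℝ⦄ ⦃u₂ : ℝ → T3 → V3⦄ ⦃x₀ : V3⦄ ⦃R : ℝ⦄,
        IsIsentropicEulerSolution (5 / 3) T₂ ρ₂ u₂ →
        (∀ y : V3, ‖y - x₀‖ < R → ρ₂ 0 (Torus.proj y) = ρ 0 y ∧ u₂ 0 (Torus.proj y) = u 0 y) →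
        ∀ ⦃t : ℝ⦄, t ∈ Ico 0 T₂ → t < T → ∀ ⦃y : V3⦄,
          ‖y - x₀‖ + M * (T ^ (1 / r) - (T - t) ^ (1 / r)) < R →
          ρ₂ t (Torus.proj y) = ρ t y ∧ u₂ t (Torus.proj y) = u t y := by
  obtain ⟨M, hM0, hM⟩ := eqOn_cone_uniform hr hU hS hode hlimU hlimS hUb hSb
  refine ⟨M, hM0, ?_⟩
  intro T u σ ρ hu hσ hρ T₂ ρ₂ u₂ x₀ R h₂ h0 t ht htT y hy
  have hMT := hM T u σ hu hσ
  have hr0 : 0 < r := one_pos.trans hr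
  -- positivity of `σ` before the blow-up time
  have hσpos : ∀ s < T, ∀ z, 0 < σ s z := by
    intro s hs z
    rw [hσ, hSb]
    exact mul_pos (mul_pos (inv_pos.mpr hr0) (Real.rpow_pos_of_pos (sub_pos.mpr hs) _))
      (hSpos _ (norm_nonneg _))
  -- a slab `[0, t₁)` with `t < t₁ ≤ T₂`, `t₁ < T`
  set t₁ : ℝ := min T₂ ((t + T) / 2) with ht₁
  have htt₁ : t < t₁ := lt_min ht.2 (by linarith)
  have ht₁T₂ : t₁ ≤ T₂ := min_le_left _ _
  have ht₁T : t₁ < T := (min_le_right _ _).trans_lt (by linarith)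
  have hγ : (1 : ℝ) < 5 / 3 := by norm_num
  have hα : ((5 : ℝ) / 3 - 1) / 2 = 1 / 3 := by norm_num
  have hT0 : (0 : ℝ) < T := ht.1.trans_lt htT
  -- the cone theorem for the lift, in the variables `(u, σ = 3ρ^{1/3})`
  have key := hMT ht₁T (u₂ := fun s z => u₂ s (Torus.proj z))
    (σ₂ := fun s z => (1 / 3 : ℝ)⁻¹ * ρ₂ s (Torus.proj z) ^ (1 / 3 : ℝ)) (x₀ := x₀) (R := R)
    (IsentropicEuler.contDiffOn_lift_velocity h₂ ht₁T₂)
    (IsentropicEuler.contDiffOn_lift_soundSpeed h₂ (1 / 3) ht₁T₂)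
    (fun s hs z _ => ?_) (fun z hz => ?_) ⟨ht.1, htt₁⟩ hy
  rotate_left
  · -- the `(u, σ)`-system for the lift (`α = (5/3 − 1)/2 = 1/3`)
    have h := IsentropicEuler.uσ_equations h₂ hγ ⟨hs.1, hs.2.trans_le ht₁T₂⟩ z
    rw [hα] at h
    exact h
  · -- the data agree on the ball
    refine ⟨(h0 z hz).2.symm, ?_⟩
    show σ 0 z = (1 / 3 : ℝ)⁻¹ * ρ₂ 0 (Torus.proj z) ^ (1 / 3 : ℝ)
    rw [(h0 z hz).1, hρ, cube_rpow_third (div_pos (hσpos 0 hT0 z) three_pos)]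
    ring
  -- back to `ρ = (σ/3)³`
  refine ⟨?_, key.1.symm⟩
  have hp : 0 < ρ₂ t (Torus.proj y) := h₂.density_pos t ht _
  have h3 : ρ₂ t (Torus.proj y) ^ (1 / 3 : ℝ) = σ t y / 3 := by
    have h : σ t y = (1 / 3 : ℝ)⁻¹ * ρ₂ t (Torus.proj y) ^ (1 / 3 : ℝ) := key.2
    rw [h]
    ring
  calc ρ₂ t (Torus.proj y) = (ρ₂ t (Torus.proj y) ^ (1 / 3 : ℝ)) ^ (3 : ℕ) := by
        rw [← Real.rpow_natCast, ← Real.rpow_mul hp.le]; norm_num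
    _ = ρ t y := by rw [h3, hρ]

end Cone

/-! ### Far-field regularity, uniformly in the blow-up time -/

section FarField

/-- **`T`-uniform far-field regularity of the exact self-similar solution.** For profiles as in
the vendored fact with `1 < r < 2` and every `n` there are `R > 0` and `C` such that for EVERY
blow-up time `T`, every `t < T` and every `x` with `|x| ≥ R (T−t)^{1/r}`:
`‖∇ⁿu_T(t,·)(x)‖ ≤ C |x|^{1−r−n}` and `‖∇ⁿσ_T(t,·)(x)‖ ≤ C |x|^{1−r−n}` (the powers of `T − t`
cancel exactly against eq. (1.6); same proof as `exactSolution_farField_iteratedFDeriv_le`, with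
the quantifiers in the `T`-uniform order).
[cite: CaolaboraEtAl2025, eq. (1.6) p. 6; §1.3 p. 5 (self-similar change of variables)] -/
theorem farField_iteratedFDeriv_uniform (hr1 : 1 < r) (hr2 : r < 2)
    (hU : ContDiff ℝ ∞ fun y : V3 => (U ‖y‖ / ‖y‖) • y) (hS : ContDiff ℝ ∞ fun y : V3 => S ‖y‖)
    (hode : ∀ ζ : ℝ, 0 < ζ →
      (r - 1) * U ζ + (ζ + U ζ) * deriv U ζ + 1 / 3 * S ζ * deriv S ζ = 0 ∧
      (r - 1) * S ζ + (ζ + U ζ) * deriv S ζ + 1 / 3 * S ζ * (deriv U ζ + 2 * U ζ / ζ) = 0)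
    (hlimU : Tendsto (fun ζ => U ζ / ζ) atTop (𝓝 0))
    (hlimS : Tendsto (fun ζ => S ζ / ζ) atTop (𝓝 0))
    (hUb : Ub = fun y : V3 => (U ‖y‖ / ‖y‖) • y) (hSb : Sb = fun y : V3 => S ‖y‖) (n : ℕ) :
    ∃ R C : ℝ, 0 < R ∧ ∀ (T : ℝ) (u : ℝ → V3 → V3) (σ : ℝ → V3 → ℝ),
      (∀ t x, u t x = (r⁻¹ * (T - t) ^ (1 / r - 1)) • Ub ((T - t) ^ (-1 / r) • x)) →
      (∀ t x, σ t x = (r⁻¹ * (T - t) ^ (1 / r - 1)) * Sb ((T - t) ^ (-1 / r) • x)) →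
      ∀ t, t < T → ∀ x : V3, R * (T - t) ^ (1 / r) ≤ ‖x‖ →
        ‖iteratedFDeriv ℝ n (u t) x‖ ≤ C * ‖x‖ ^ (1 - r - n) ∧
          ‖iteratedFDeriv ℝ n (σ t) x‖ ≤ C * ‖x‖ ^ (1 - r - n) := by
  obtain ⟨R₁, C₁, hR₁, hC₁⟩ := norm_iteratedFDeriv_radialField_sharp hr1 hr2 hU hS hode hlimU hlimS n
  obtain ⟨R₂, C₂, hR₂, hC₂⟩ := norm_iteratedFDeriv_radialScalar_sharp hr1 hr2 hU hS hode hlimU hlimS n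
  have hr0 : 0 < r := by linarith
  have hUb' : ContDiff ℝ ∞ Ub := hUb ▸ hU
  have hSb' : ContDiff ℝ ∞ Sb := hSb ▸ hS
  refine ⟨max R₁ R₂, r⁻¹ * max C₁ C₂, lt_max_of_lt_left hR₁, fun T u σ hu hσ t ht x hx => ?_⟩
  -- the powers of `l = T - t`
  have hl : 0 < T - t := sub_pos.2 ht
  set a : ℝ := r⁻¹ * (T - t) ^ (1 / r - 1) with ha
  set e : ℝ := (T - t) ^ (-1 / r) with he
  have ha0 : 0 < a := mul_pos (inv_pos.2 hr0) (Real.rpow_pos_of_pos hl _)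
  have he0 : 0 < e := Real.rpow_pos_of_pos hl _
  -- `e (T-t)^{1/r} = 1`, so `‖e • x‖ = e ‖x‖ ≥ max R₁ R₂`
  have hel : e * (T - t) ^ (1 / r) = 1 := by
    rw [he, ← Real.rpow_add hl]
    rw [show (-1 / r + 1 / r : ℝ) = 0 by ring, Real.rpow_zero]
  have hRpos : 0 < max R₁ R₂ := lt_max_of_lt_left hR₁
  have hx0 : 0 < ‖x‖ := lt_of_lt_of_le (mul_pos hRpos (Real.rpow_pos_of_pos hl _)) hx
  have hex : ‖e • x‖ = e * ‖x‖ := by rw [norm_smul, Real.norm_eq_abs, abs_of_pos he0]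
  have hexR : max R₁ R₂ ≤ ‖e • x‖ := by
    rw [hex]
    have h1 : e * (max R₁ R₂ * (T - t) ^ (1 / r)) ≤ e * ‖x‖ := mul_le_mul_of_nonneg_left hx he0.le
    calc max R₁ R₂ = e * (max R₁ R₂ * (T - t) ^ (1 / r)) := by
          rw [show e * (max R₁ R₂ * (T - t) ^ (1 / r)) = max R₁ R₂ * (e * (T - t) ^ (1 / r)) by ring,
            hel, mul_one]
      _ ≤ e * ‖x‖ := h1
  -- the cancellation of the powers: `a eⁿ (e‖x‖)^{1-r-n} = r⁻¹ ‖x‖^{1-r-n}`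
  have hcancel : a * e ^ n * (e * ‖x‖) ^ (1 - r - n) = r⁻¹ * ‖x‖ ^ (1 - r - n) := by
    rw [Real.mul_rpow he0.le hx0.le, ha, he]
    have h1 : ((T - t) ^ (-1 / r)) ^ n = (T - t) ^ (-1 / r * n) := by
      rw [Real.rpow_mul hl.le, Real.rpow_natCast]
    have h2 : ((T - t) ^ (-1 / r)) ^ (1 - r - (n : ℝ)) = (T - t) ^ (-1 / r * (1 - r - n)) := by
      rw [Real.rpow_mul hl.le]
    rw [h1, h2]
    have h3 : (T - t) ^ (1 / r - 1) * (T - t) ^ (-1 / r * (n : ℝ)) *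
        (T - t) ^ (-1 / r * (1 - r - n)) = 1 := by
      rw [← Real.rpow_add hl, ← Real.rpow_add hl]
      rw [show (1 / r - 1 + -1 / r * (n : ℝ) + -1 / r * (1 - r - n)) = 0 by field_simp; ring,
        Real.rpow_zero]
    calc r⁻¹ * (T - t) ^ (1 / r - 1) * (T - t) ^ (-1 / r * ↑n) *
          ((T - t) ^ (-1 / r * (1 - r - ↑n)) * ‖x‖ ^ (1 - r - ↑n))
        = r⁻¹ * ((T - t) ^ (1 / r - 1) * (T - t) ^ (-1 / r * ↑n) *
            (T - t) ^ (-1 / r * (1 - r - ↑n))) * ‖x‖ ^ (1 - r - ↑n) := by ring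
      _ = r⁻¹ * ‖x‖ ^ (1 - r - ↑n) := by rw [h3, mul_one]
  -- the generic estimate
  have key : ∀ {G : Type} [NormedAddCommGroup G] [NormedSpace ℝ G] {F : V3 → G} {CF : ℝ},
      ContDiff ℝ ∞ F → ‖iteratedFDeriv ℝ n F (e • x)‖ ≤ CF * ‖e • x‖ ^ (1 - r - n) →
      CF ≤ max C₁ C₂ →
      ‖iteratedFDeriv ℝ n (fun x => a • F (e • x)) x‖ ≤ r⁻¹ * max C₁ C₂ * ‖x‖ ^ (1 - r - n) := by
    intro G _ _ F CF hF hB hCF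
    have hFe : ContDiff ℝ ∞ fun x : V3 => F (e • x) := hF.comp (contDiff_const_smul e)
    rw [iteratedFDeriv_const_smul_apply' (hFe.contDiffAt.of_le (by exact_mod_cast le_top)), norm_smul,
      Real.norm_eq_abs, abs_of_pos ha0]
    have hpow : 0 ≤ (e * ‖x‖) ^ (1 - r - n) := Real.rpow_nonneg (by positivity) _
    calc a * ‖iteratedFDeriv ℝ n (fun x => F (e • x)) x‖
        ≤ a * (e ^ n * ‖iteratedFDeriv ℝ n F (e • x)‖) :=
          mul_le_mul_of_nonneg_left (norm_iteratedFDeriv_comp_smul_le hF he0.le n x) ha0.le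
      _ ≤ a * (e ^ n * (CF * ‖e • x‖ ^ (1 - r - n))) := by gcongr
      _ = CF * (a * e ^ n * (e * ‖x‖) ^ (1 - r - n)) := by rw [hex]; ring
      _ = CF * (r⁻¹ * ‖x‖ ^ (1 - r - n)) := by rw [hcancel]
      _ ≤ max C₁ C₂ * (r⁻¹ * ‖x‖ ^ (1 - r - n)) :=
          mul_le_mul_of_nonneg_right hCF (by positivity)
      _ = r⁻¹ * max C₁ C₂ * ‖x‖ ^ (1 - r - n) := by ring
  constructor
  · have hfun : u t = fun x => a • Ub (e • x) := funext fun x => hu t x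
    rw [hfun]
    refine key hUb' ?_ (le_max_left _ _)
    rw [hUb]
    exact hC₁ _ ((le_max_left _ _).trans hexR)
  · have hfun : σ t = fun x => a • Sb (e • x) := funext fun x => by rw [hσ t x, smul_eq_mul]
    rw [hfun]
    refine key hSb' ?_ (le_max_right _ _)
    rw [hSb]
    exact hC₂ _ ((le_max_right _ _).trans hexR)

/-- **`T`-uniform far-field lower bound for the sound speed of the exact solution:**
`σ_T(t,x) ≥ c |x|^{1−r}` for `|x| ≥ R (T−t)^{1/r}`, with `R, c > 0` independent of `t` and of
the blow-up time `T` (from `S̄(ζ) ≥ c ζ^{1−r}` for `ζ ≥ ζ₀`, `profile_soundSpeed_lower`; the powers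
of `T − t` cancel). In physical variables the far field of the density is thus bounded below
INDEPENDENTLY of time ("the profile of `S` is time-independent in the far field", p. 26 of the
source). [cite: CaolaboraEtAl2025, eq. (1.6) p. 6 (`S̄ ≳ ⟨R⟩^{−r+1}`), p. 26; §1.3 p. 5] -/
theorem farField_soundSpeed_lower_uniform (hr1 : 1 < r) (hr2 : r < 2)
    (hU : ContDiff ℝ ∞ fun y : V3 => (U ‖y‖ / ‖y‖) • y) (hS : ContDiff ℝ ∞ fun y : V3 => S ‖y‖)
    (hode : ∀ ζ : ℝ, 0 < ζ →
      (r - 1) * U ζ + (ζ + U ζ) * deriv U ζ + 1 / 3 * S ζ * deriv S ζ = 0 ∧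
      (r - 1) * S ζ + (ζ + U ζ) * deriv S ζ + 1 / 3 * S ζ * (deriv U ζ + 2 * U ζ / ζ) = 0)
    (hSpos : ∀ ζ : ℝ, 0 ≤ ζ → 0 < S ζ)
    (hlimU : Tendsto (fun ζ => U ζ / ζ) atTop (𝓝 0))
    (hlimS : Tendsto (fun ζ => S ζ / ζ) atTop (𝓝 0))
    (hSb : Sb = fun y : V3 => S ‖y‖) :
    ∃ R c : ℝ, 0 < R ∧ 0 < c ∧ ∀ (T : ℝ) (σ : ℝ → V3 → ℝ),
      (∀ t x, σ t x = (r⁻¹ * (T - t) ^ (1 / r - 1)) * Sb ((T - t) ^ (-1 / r) • x)) →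
      ∀ t, t < T → ∀ x : V3, R * (T - t) ^ (1 / r) ≤ ‖x‖ → c * ‖x‖ ^ (1 - r) ≤ σ t x := by
  obtain ⟨ζ₀, c₁, hζ₀, hc₁, hlow⟩ := profile_soundSpeed_lower hr1 hr2 hU hS hode hSpos hlimU hlimS
  have hr0 : 0 < r := by linarith
  refine ⟨ζ₀, r⁻¹ * c₁, hζ₀, mul_pos (inv_pos.2 hr0) hc₁, fun T σ hσ t ht x hx => ?_⟩
  have hl : 0 < T - t := sub_pos.2 ht
  set e : ℝ := (T - t) ^ (-1 / r) with he
  have he0 : 0 < e := Real.rpow_pos_of_pos hl _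
  have hel : e * (T - t) ^ (1 / r) = 1 := by
    rw [he, ← Real.rpow_add hl]
    rw [show (-1 / r + 1 / r : ℝ) = 0 by ring, Real.rpow_zero]
  have hx0 : 0 < ‖x‖ := lt_of_lt_of_le (mul_pos hζ₀ (Real.rpow_pos_of_pos hl _)) hx
  have hex : ‖e • x‖ = e * ‖x‖ := by rw [norm_smul, Real.norm_eq_abs, abs_of_pos he0]
  -- `ζ = ‖e • x‖ ≥ ζ₀`
  have hζ : ζ₀ ≤ e * ‖x‖ := by
    have h1 : e * (ζ₀ * (T - t) ^ (1 / r)) ≤ e * ‖x‖ := mul_le_mul_of_nonneg_left hx he0.le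
    calc ζ₀ = e * (ζ₀ * (T - t) ^ (1 / r)) := by
          rw [show e * (ζ₀ * (T - t) ^ (1 / r)) = ζ₀ * (e * (T - t) ^ (1 / r)) by ring, hel, mul_one]
      _ ≤ e * ‖x‖ := h1
  have hSζ := hlow (e * ‖x‖) hζ
  -- the cancellation of the powers
  have hcancel : (T - t) ^ (1 / r - 1) * (e * ‖x‖) ^ (1 - r) = ‖x‖ ^ (1 - r) := by
    rw [Real.mul_rpow he0.le hx0.le, he, ← Real.rpow_mul hl.le]
    have h3 : (T - t) ^ (1 / r - 1) * (T - t) ^ (-1 / r * (1 - r)) = 1 := by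
      rw [← Real.rpow_add hl]
      rw [show (1 / r - 1 + -1 / r * (1 - r) : ℝ) = 0 by field_simp; ring, Real.rpow_zero]
    calc (T - t) ^ (1 / r - 1) * ((T - t) ^ (-1 / r * (1 - r)) * ‖x‖ ^ (1 - r))
        = ((T - t) ^ (1 / r - 1) * (T - t) ^ (-1 / r * (1 - r))) * ‖x‖ ^ (1 - r) := by ring
      _ = ‖x‖ ^ (1 - r) := by rw [h3, one_mul]
  have hσx : σ t x = r⁻¹ * (T - t) ^ (1 / r - 1) * S (e * ‖x‖) := by
    rw [hσ, hSb]
    simp only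
    rw [hex]
  rw [hσx]
  have hpow : 0 ≤ (T - t) ^ (1 / r - 1) := (Real.rpow_pos_of_pos hl _).le
  calc r⁻¹ * c₁ * ‖x‖ ^ (1 - r) = r⁻¹ * (T - t) ^ (1 / r - 1) * (c₁ * (e * ‖x‖) ^ (1 - r)) := by
        rw [← hcancel]; ring
    _ ≤ r⁻¹ * (T - t) ^ (1 / r - 1) * S (e * ‖x‖) :=
        mul_le_mul_of_nonneg_left hSζ (mul_nonneg (inv_nonneg.2 hr0.le) hpow)

end FarField

end CaolaboraEtAl2025

end Literature.Analysis.FluidPDE
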